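import Literature.Barriers.FinalStateConjecture.NonSmoothNullInfinityPrimitives
import Literature.Barriers.FinalStateConjecture.NonSmoothNullInfinityScatteringProofs
import Mathlib.Topology.ContinuousMap.Bounded.Normed
import Mathlib.Topology.MetricSpace.Contracting
import Mathlib.Analysis.Calculus.FDeriv.Partial
import Mathlib.Analysis.SpecialFunctions.ExpDeriv
import Mathlib.Analysis.Calculus.Deriv.Polynomial
import Mathlib.Topology.Algebra.Polynomial
import HarnessLib

/-!
# Barrier catalogue `FinalStateConjecture`: existence of the linear scattering solution on
# Schwarzschild (discharge of `SchwarzschildLinearScattering_exists`)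
(`Literature/Barriers/FinalStateConjecture/`; namespace `Literature.Barriers.FinalStateConjecture`)

For `M > 0`, an EF area radius `r`, an advanced time `v₁` and data `H` (continuous, bounded,
`H = 0` on `(−∞, v₁]`), the scattering solution of `∂ᵤ∂ᵥψ = −V(r)ψ` (`V = radialPotential M`)
with `ψ → H` on `𝓘⁻` and `ψ = 0` for `v ≤ v₁` is constructed as the fixed point of
`ψ = H − ∫_{v₁}^{v} ∫_{−∞}^{u} V ψ du' dv'` (Kehrberger, arXiv:2105.08079, Thm. 6.1/6.2: "The
existence of the scattering solution follows by our previous methods"): in the unknown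
`φ = e^{−(v−v₁)/2M} ψ` the map is a `1/2`-contraction of the Banach space of bounded continuous
functions on `ℝ²` (the ingoing null-line integral of the potential is `M/r² < 1/4M`,
`IsEFAreaRadius.integral_potential_Iic`), and its fixed point is continuous, vanishes for
`v ≤ v₁`, is bounded on past strips, satisfies the integrated equation, has the partial derivatives
`∂ᵤψ = −∫_{v₁}^{v} Vψ`, `∂ᵥψ = H' − ∫_{−∞}^{u} Vψ`, and attains `H` on `𝓘⁻`
(`scatteringField` and its API). Smoothness for smooth data is a bootstrap over the family of
functions generated from `ψ` and the `H^{(j)}` by sums, polynomial-in-`1/r` multipliers and the two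
null-line primitives (`ScatFam`): the family is closed under both partial derivatives, so by the
`C¹`-criterion from continuous partial derivatives (`hasStrictFDerivAt_uncurry_coprod`) all its
members are `C^∞`; the wave equation in the nesting of `IsRadiationFieldOnSchwarzschild` is then
read off from `∂ᵤ(∂ᵥψ) = −Vψ`. This proves `SchwarzschildLinearScattering_exists_holds` (the
companion facts `_unique` and `_timeIntegral` are discharged in the tree's
`NonSmoothNullInfinityScatteringProofs.lean`, imported here for `SchwarzschildLinearScattering_unique_holds`).

## References

* L. M. A. Kehrberger, Ann. Henri Poincaré 23 (2022) 829–921 = arXiv:2105.08079, §6 (Thm. 6.1,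
  §6.2 eq. (6.14), Thm. 6.2). Key `Kehrberger2022AHP`.
* Standard: Banach fixed point / Picard iteration for the characteristic (Goursat) problem of a
  linear `1+1` wave equation, e.g. R. Courant, D. Hilbert, *Methods of Mathematical Physics II*,
  Ch. V §5. [folklore]
-/

noncomputable section

open Set Filter Topology MeasureTheory intervalIntegral Function
open scoped BoundedContinuousFunction NNReal

namespace Literature.Barriers.FinalStateConjecture

/-! ### The exponential weight in `v` -/

/-- The weight `ω(v) = exp(−(v − v₁)/(2M))` (`λ = 1/2M` makes the solution operator a
`1/2`-contraction: `∫_{−∞}^{u} V ≤ 1/4M`). [folklore] -/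
def scatWeight (M v₁ v : ℝ) : ℝ := Real.exp (-((v - v₁) / (2 * M)))

section Weight

variable {M v₁ : ℝ}

/-- `ω > 0`. [folklore] -/
lemma scatWeight_pos (M v₁ v : ℝ) : 0 < scatWeight M v₁ v := Real.exp_pos _

/-- `ω ≠ 0`. [folklore] -/
lemma scatWeight_ne_zero (M v₁ v : ℝ) : scatWeight M v₁ v ≠ 0 := (scatWeight_pos M v₁ v).ne'

/-- `ω(v₁) = 1`. [folklore] -/
@[simp] lemma scatWeight_self (M v₁ : ℝ) : scatWeight M v₁ v₁ = 1 := by simp [scatWeight]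

/-- `ω(v)⁻¹ = exp((v − v₁)/2M)`. [folklore] -/
lemma scatWeight_inv (M v₁ v : ℝ) : (scatWeight M v₁ v)⁻¹ = Real.exp ((v - v₁) / (2 * M)) := by
  rw [scatWeight, Real.exp_neg, inv_inv]

/-- `ω` is continuous. [folklore] -/
lemma continuous_scatWeight (M v₁ : ℝ) : Continuous (scatWeight M v₁) := by
  unfold scatWeight; fun_prop

/-- `ω⁻¹` is continuous. [folklore] -/
lemma continuous_scatWeight_inv (M v₁ : ℝ) : Continuous (fun v ↦ (scatWeight M v₁ v)⁻¹) := by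
  simp only [scatWeight_inv]; fun_prop

/-- `ω ≤ 1` on `v ≥ v₁` (`M > 0`). [folklore] -/
lemma scatWeight_le_one (hM : 0 < M) {v : ℝ} (hv : v₁ ≤ v) : scatWeight M v₁ v ≤ 1 := by
  rw [scatWeight, Real.exp_le_one_iff, neg_nonpos]
  exact div_nonneg (sub_nonneg.2 hv) (by positivity)

/-- `ω⁻¹` is monotone in `v` (`M > 0`): on `{v ≤ V}`, `ω(v)⁻¹ ≤ ω(V)⁻¹`. [folklore] -/
lemma scatWeight_inv_le (hM : 0 < M) {v V : ℝ} (hv : v ≤ V) :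
    (scatWeight M v₁ v)⁻¹ ≤ (scatWeight M v₁ V)⁻¹ := by
  rw [scatWeight_inv, scatWeight_inv, Real.exp_le_exp]
  exact div_le_div_of_nonneg_right (by linarith) (by positivity)

/-- `∫_{v₁}^{v} ω⁻¹ = 2M (ω(v)⁻¹ − 1)`. [folklore] -/
lemma integral_scatWeight_inv (hM : 0 < M) (v : ℝ) :
    ∫ v' in v₁..v, (scatWeight M v₁ v')⁻¹ = 2 * M * ((scatWeight M v₁ v)⁻¹ - 1) := by
  have h2M : (2 * M) ≠ 0 := by positivity
  have hderiv : ∀ x : ℝ, HasDerivAt (fun v' ↦ 2 * M * Real.exp ((v' - v₁) / (2 * M)))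
      ((scatWeight M v₁ x)⁻¹) x := by
    intro x
    have h1 : HasDerivAt (fun v' : ℝ ↦ (v' - v₁) / (2 * M)) (1 / (2 * M)) x := by
      simpa using ((hasDerivAt_id x).sub_const v₁).div_const (2 * M)
    have h2 := (h1.exp).const_mul (2 * M)
    rw [scatWeight_inv]
    refine h2.congr_deriv ?_
    field_simp
  rw [intervalIntegral.integral_eq_sub_of_hasDerivAt (fun x _ ↦ hderiv x)
    ((continuous_scatWeight_inv M v₁).intervalIntegrable _ _)]
  simp only [scatWeight_inv, sub_self, zero_div, Real.exp_zero]
  ring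

/-- The key inequality: `ω(v) ∫_{v₁}^{v} ω⁻¹ = 2M(1 − ω(v)) ≤ 2M` and `≥ 0` on `v ≥ v₁`. [folklore] -/
lemma scatWeight_mul_integral (hM : 0 < M) (v : ℝ) :
    scatWeight M v₁ v * ∫ v' in v₁..v, (scatWeight M v₁ v')⁻¹ = 2 * M * (1 - scatWeight M v₁ v) := by
  rw [integral_scatWeight_inv hM]
  have := scatWeight_ne_zero M v₁ v
  field_simp

end Weight

/-! ### The solution operator on bounded continuous functions and its fixed point -/

section FixedPoint

variable {M : ℝ} {r : ℝ → ℝ → ℝ} {v₁ : ℝ} {H : ℝ → ℝ}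

/-- The potential-weighted integrand `V(r(u,v)) ω(v)⁻¹ φ(u,v)` attached to `φ ∈ BCF(ℝ²)`.
[folklore] -/
def scatIntegrand (M : ℝ) (r : ℝ → ℝ → ℝ) (v₁ : ℝ) (φ : ℝ × ℝ →ᵇ ℝ) (u v : ℝ) : ℝ :=
  radialPotential M (r u v) * ((scatWeight M v₁ v)⁻¹ * φ (u, v))

/-- The solution operator before packaging: `𝒯φ(u,v) = ω(v)(H(v) − ∫_{v₁}^{max v v₁} ∫_{−∞}^{u} V ω⁻¹ φ)`
(the truncation at `v₁` makes `𝒯φ = 0` on `{v ≤ v₁}` for every `φ`). [folklore] -/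
def scatOpFun (M : ℝ) (r : ℝ → ℝ → ℝ) (v₁ : ℝ) (H : ℝ → ℝ) (φ : ℝ × ℝ →ᵇ ℝ) (p : ℝ × ℝ) : ℝ :=
  scatWeight M v₁ p.2 *
    (H p.2 - vPrimitive v₁ (uPrimitive (scatIntegrand M r v₁ φ)) p.1 (max p.2 v₁))

variable (hr : IsEFAreaRadius M r) (hM : 0 < M)
include hr hM

/-- `(u, v) ↦ V(r(u,v))` is continuous. [folklore] -/
lemma continuous_potential : Continuous (fun p : ℝ × ℝ ↦ radialPotential M (r p.1 p.2)) := by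
  have hc : Continuous (uncurry r) := (hr.contDiff_uncurry hM).continuous
  have h0 : ∀ p : ℝ × ℝ, uncurry r p ≠ 0 := fun p ↦ (hr.pos hM.le p.1 p.2).ne'
  simp only [radialPotential]
  have h4 : Continuous fun p : ℝ × ℝ ↦ 2 * M / r p.1 p.2 := continuous_const.div hc h0
  exact (continuous_const.mul (continuous_const.sub h4)).div (hc.pow 3) fun p ↦ pow_ne_zero 3 (h0 p)

omit hr hM in
/-- Pointwise bound `|φ p| ≤ ‖φ‖`. [folklore] -/
lemma abs_apply_le_norm (φ : ℝ × ℝ →ᵇ ℝ) (p : ℝ × ℝ) : |φ p| ≤ ‖φ‖ := by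
  simpa [Real.norm_eq_abs] using φ.norm_coe_le_norm p

/-- The integrand is continuous. [folklore] -/
lemma continuous_scatIntegrand (φ : ℝ × ℝ →ᵇ ℝ) : Continuous (uncurry (scatIntegrand M r v₁ φ)) := by
  have h1 := continuous_potential hr hM
  have h2 : Continuous (fun p : ℝ × ℝ ↦ (scatWeight M v₁ p.2)⁻¹) :=
    (continuous_scatWeight_inv M v₁).comp continuous_snd
  exact h1.mul (h2.mul φ.continuous)

/-- The integrand is potential-dominated: `|V ω⁻¹ φ| ≤ ω(V)⁻¹ ‖φ‖ V` on `{v ≤ V}`. [folklore] -/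
lemma isPotentialDominated_scatIntegrand (φ : ℝ × ℝ →ᵇ ℝ) :
    IsPotentialDominated M r (scatIntegrand M r v₁ φ) := by
  intro V
  refine ⟨(scatWeight M v₁ V)⁻¹ * ‖φ‖, fun u v hv ↦ ?_⟩
  have hp : 0 ≤ radialPotential M (r u v) := (radialPotential_pos hM (hr.1 u v)).le
  rw [scatIntegrand, abs_mul, abs_of_nonneg hp, mul_comm, abs_mul,
    abs_of_pos (inv_pos.2 (scatWeight_pos M v₁ v))]
  refine mul_le_mul_of_nonneg_right ?_ hp
  exact mul_le_mul (scatWeight_inv_le hM hv) (abs_apply_le_norm φ _) (abs_nonneg _)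
    (inv_pos.2 (scatWeight_pos M v₁ V)).le

/-- The inner integral is bounded by `‖φ‖ ω(v)⁻¹ M/r² ≤ ‖φ‖ ω(v)⁻¹/(4M)`. [folklore] -/
lemma abs_uPrimitive_scatIntegrand_le (φ : ℝ × ℝ →ᵇ ℝ) (u v : ℝ) :
    |uPrimitive (scatIntegrand M r v₁ φ) u v| ≤ ‖φ‖ * (scatWeight M v₁ v)⁻¹ * (1 / (4 * M)) := by
  have h := abs_uPrimitive_le hr hM (h := scatIntegrand M r v₁ φ) (B := ‖φ‖ * (scatWeight M v₁ v)⁻¹)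
    (u := u) (v := v) fun u' ↦ ?_
  · refine h.trans (mul_le_mul_of_nonneg_left (div_sq_lt hr hM u v).le ?_)
    exact mul_nonneg (norm_nonneg _) (inv_pos.2 (scatWeight_pos M v₁ v)).le
  · have hp : 0 ≤ radialPotential M (r u' v) := (radialPotential_pos hM (hr.1 u' v)).le
    rw [scatIntegrand, abs_mul, abs_of_nonneg hp, mul_comm, abs_mul,
      abs_of_pos (inv_pos.2 (scatWeight_pos M v₁ v)), mul_comm ((scatWeight M v₁ v)⁻¹)]
    exact mul_le_mul_of_nonneg_right (mul_le_mul_of_nonneg_right (abs_apply_le_norm φ _)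
      (inv_pos.2 (scatWeight_pos M v₁ v)).le) hp

/-- The inner integral is jointly continuous. [folklore] -/
lemma continuous_uPrimitive_scatIntegrand (φ : ℝ × ℝ →ᵇ ℝ) :
    Continuous (uncurry (uPrimitive (scatIntegrand M r v₁ φ))) :=
  continuous_uPrimitive hr hM (isPotentialDominated_scatIntegrand hr hM φ)
    (continuous_scatIntegrand hr hM φ)

/-- The outer integral on `v ≥ v₁`: `|∫_{v₁}^{v} ∫_{−∞}^{u} V ω⁻¹ φ| ≤ ‖φ‖ (ω(v)⁻¹ − 1)/2`. [folklore] -/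
lemma abs_vPrimitive_scatIntegrand_le (φ : ℝ × ℝ →ᵇ ℝ) (u : ℝ) {v : ℝ} (hv : v₁ ≤ v) :
    |vPrimitive v₁ (uPrimitive (scatIntegrand M r v₁ φ)) u v| ≤
      ‖φ‖ * ((scatWeight M v₁ v)⁻¹ - 1) / 2 := by
  rw [vPrimitive_apply]
  have hint : IntervalIntegrable (fun v' ↦ ‖φ‖ * (scatWeight M v₁ v')⁻¹ * (1 / (4 * M))) volume v₁ v :=
    ((continuous_const.mul (continuous_scatWeight_inv M v₁)).mul continuous_const).intervalIntegrable _ _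
  have h := intervalIntegral.norm_integral_le_of_norm_le hv (f := fun v' ↦
      uPrimitive (scatIntegrand M r v₁ φ) u v')
    (Eventually.of_forall fun v' _ ↦ ?_) hint
  · rw [Real.norm_eq_abs] at h
    refine h.trans (le_of_eq ?_)
    rw [intervalIntegral.integral_mul_const, intervalIntegral.integral_const_mul,
      integral_scatWeight_inv hM]
    field_simp
    ring
  · rw [Real.norm_eq_abs]
    exact abs_uPrimitive_scatIntegrand_le hr hM φ u v'

/-- `𝒯φ` is continuous. [folklore] -/
lemma continuous_scatOpFun (hHc : Continuous H) (φ : ℝ × ℝ →ᵇ ℝ) :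
    Continuous (scatOpFun M r v₁ H φ) := by
  have h1 : Continuous (fun p : ℝ × ℝ ↦ scatWeight M v₁ p.2) :=
    (continuous_scatWeight M v₁).comp continuous_snd
  have h2 : Continuous (fun p : ℝ × ℝ ↦ H p.2) := hHc.comp continuous_snd
  have h3 := continuous_vPrimitive (v₁ := v₁) (continuous_uPrimitive_scatIntegrand (v₁ := v₁) hr hM φ)
  have h4 : Continuous (fun p : ℝ × ℝ ↦
      vPrimitive v₁ (uPrimitive (scatIntegrand M r v₁ φ)) p.1 (max p.2 v₁)) :=
    h3.comp (continuous_fst.prodMk ((continuous_snd.max continuous_const)))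
  exact h1.mul (h2.sub h4)

omit hr hM in
/-- `𝒯φ` vanishes on `{v ≤ v₁}` (if `H` does). [folklore] -/
lemma scatOpFun_eq_zero (hH0 : ∀ v, v ≤ v₁ → H v = 0) (φ : ℝ × ℝ →ᵇ ℝ) {p : ℝ × ℝ} (hp : p.2 ≤ v₁) :
    scatOpFun M r v₁ H φ p = 0 := by
  simp [scatOpFun, max_eq_right hp, hH0 p.2 hp]

/-- The bound `|𝒯φ| ≤ C_H + ‖φ‖/2` (`|H| ≤ C_H`). [folklore] -/
lemma abs_scatOpFun_le {CH : ℝ} (hHb : ∀ v, |H v| ≤ CH) (hH0 : ∀ v, v ≤ v₁ → H v = 0)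
    (φ : ℝ × ℝ →ᵇ ℝ) (p : ℝ × ℝ) : |scatOpFun M r v₁ H φ p| ≤ CH + ‖φ‖ / 2 := by
  have hCH : 0 ≤ CH := (abs_nonneg _).trans (hHb 0)
  rcases le_or_gt p.2 v₁ with hp | hp
  · rw [scatOpFun_eq_zero hH0 φ hp, abs_zero]; positivity
  · have hw : 0 < scatWeight M v₁ p.2 := scatWeight_pos M v₁ p.2
    have hw1 : scatWeight M v₁ p.2 ≤ 1 := scatWeight_le_one hM hp.le
    rw [scatOpFun, max_eq_left hp.le, abs_mul, abs_of_pos hw]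
    have hI := abs_vPrimitive_scatIntegrand_le hr hM φ p.1 hp.le
    calc scatWeight M v₁ p.2 * |H p.2 - vPrimitive v₁ (uPrimitive (scatIntegrand M r v₁ φ)) p.1 p.2|
        ≤ scatWeight M v₁ p.2 * (CH + ‖φ‖ * ((scatWeight M v₁ p.2)⁻¹ - 1) / 2) := by
          refine mul_le_mul_of_nonneg_left ((abs_sub _ _).trans (add_le_add (hHb _) hI)) hw.le
      _ = scatWeight M v₁ p.2 * CH + ‖φ‖ * (1 - scatWeight M v₁ p.2) / 2 := by
          field_simp
      _ ≤ 1 * CH + ‖φ‖ * 1 / 2 := by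
          gcongr
          · linarith [hw.le]
      _ = CH + ‖φ‖ / 2 := by ring

/-- **The solution operator** `𝒯 : BCF(ℝ²) → BCF(ℝ²)`. [folklore] -/
def scatOp (hHc : Continuous H) {CH : ℝ} (hHb : ∀ v, |H v| ≤ CH) (hH0 : ∀ v, v ≤ v₁ → H v = 0)
    (φ : ℝ × ℝ →ᵇ ℝ) : ℝ × ℝ →ᵇ ℝ :=
  BoundedContinuousFunction.ofNormedAddCommGroup (scatOpFun M r v₁ H φ)
    (continuous_scatOpFun hr hM hHc φ) (CH + ‖φ‖ / 2) fun p ↦ by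
      rw [Real.norm_eq_abs]; exact abs_scatOpFun_le hr hM hHb hH0 φ p

variable (hHc : Continuous H) {CH : ℝ} (hHb : ∀ v, |H v| ≤ CH) (hH0 : ∀ v, v ≤ v₁ → H v = 0)

/-- Unfolding lemma for `scatOp`. [folklore] -/
@[simp] lemma scatOp_apply (φ : ℝ × ℝ →ᵇ ℝ) (p : ℝ × ℝ) :
    scatOp hr hM hHc hHb hH0 φ p = scatOpFun M r v₁ H φ p := rfl

omit hr hM in
/-- The integrand depends linearly on `φ`. [folklore] -/
lemma scatIntegrand_sub (φ₁ φ₂ : ℝ × ℝ →ᵇ ℝ) :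
    scatIntegrand M r v₁ (φ₁ - φ₂) = fun u v ↦ scatIntegrand M r v₁ φ₁ u v - scatIntegrand M r v₁ φ₂ u v := by
  funext u v
  simp only [scatIntegrand, BoundedContinuousFunction.coe_sub, Pi.sub_apply]
  ring

/-- **`𝒯` is a `1/2`-contraction.** [folklore] -/
theorem dist_scatOp_le (φ₁ φ₂ : ℝ × ℝ →ᵇ ℝ) :
    dist (scatOp hr hM hHc hHb hH0 φ₁) (scatOp hr hM hHc hHb hH0 φ₂) ≤ (1 / 2) * dist φ₁ φ₂ := by
  refine (BoundedContinuousFunction.dist_le (by positivity)).2 fun p ↦ ?_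
  rw [scatOp_apply, scatOp_apply, Real.dist_eq, dist_eq_norm]
  rcases le_or_gt p.2 v₁ with hp | hp
  · rw [scatOpFun_eq_zero hH0 φ₁ hp, scatOpFun_eq_zero hH0 φ₂ hp, sub_zero, abs_zero]
    positivity
  · have hw : 0 < scatWeight M v₁ p.2 := scatWeight_pos M v₁ p.2
    -- linearity of the double integral in `φ`
    have hlin : vPrimitive v₁ (uPrimitive (scatIntegrand M r v₁ φ₁)) p.1 p.2 -
        vPrimitive v₁ (uPrimitive (scatIntegrand M r v₁ φ₂)) p.1 p.2 =
        vPrimitive v₁ (uPrimitive (scatIntegrand M r v₁ (φ₁ - φ₂))) p.1 p.2 := by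
      rw [scatIntegrand_sub, uPrimitive_sub hr hM (isPotentialDominated_scatIntegrand hr hM φ₁)
        (continuous_scatIntegrand hr hM φ₁) (isPotentialDominated_scatIntegrand hr hM φ₂)
        (continuous_scatIntegrand hr hM φ₂), vPrimitive_sub (continuous_uPrimitive_scatIntegrand hr hM φ₁)
        (continuous_uPrimitive_scatIntegrand hr hM φ₂)]
    have heq : scatOpFun M r v₁ H φ₁ p - scatOpFun M r v₁ H φ₂ p =
        -(scatWeight M v₁ p.2 * vPrimitive v₁ (uPrimitive (scatIntegrand M r v₁ (φ₁ - φ₂))) p.1 p.2) := by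
      simp only [scatOpFun, max_eq_left hp.le, ← hlin]
      ring
    rw [heq, abs_neg, abs_mul, abs_of_pos hw]
    have hI := abs_vPrimitive_scatIntegrand_le hr hM (φ₁ - φ₂) p.1 hp.le
    calc scatWeight M v₁ p.2 * |vPrimitive v₁ (uPrimitive (scatIntegrand M r v₁ (φ₁ - φ₂))) p.1 p.2|
        ≤ scatWeight M v₁ p.2 * (‖φ₁ - φ₂‖ * ((scatWeight M v₁ p.2)⁻¹ - 1) / 2) :=
          mul_le_mul_of_nonneg_left hI hw.le
      _ = ‖φ₁ - φ₂‖ * (1 - scatWeight M v₁ p.2) / 2 := by field_simp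
      _ ≤ ‖φ₁ - φ₂‖ * 1 / 2 := by gcongr; linarith [hw.le]
      _ = 1 / 2 * ‖φ₁ - φ₂‖ := by ring

/-- `𝒯` is contracting with constant `1/2`. [folklore] -/
theorem contractingWith_scatOp : ContractingWith (1 / 2) (scatOp hr hM hHc hHb hH0) := by
  refine ⟨by norm_num, LipschitzWith.of_dist_le_mul fun φ₁ φ₂ ↦ ?_⟩
  have h := dist_scatOp_le hr hM hHc hHb hH0 φ₁ φ₂
  norm_num at h ⊢
  linarith

/-- The fixed point `φ⋆` of `𝒯`. [folklore] -/
def scatFixedPoint : ℝ × ℝ →ᵇ ℝ :=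
  ContractingWith.fixedPoint (scatOp hr hM hHc hHb hH0) (contractingWith_scatOp hr hM hHc hHb hH0)

/-- `𝒯 φ⋆ = φ⋆`. [folklore] -/
lemma scatFixedPoint_isFixedPt :
    scatOp hr hM hHc hHb hH0 (scatFixedPoint hr hM hHc hHb hH0) = scatFixedPoint hr hM hHc hHb hH0 :=
  (contractingWith_scatOp hr hM hHc hHb hH0).fixedPoint_isFixedPt

/-- **The scattering field** `ψ = ω⁻¹ φ⋆` with data `H` on `𝓘⁻` and no incoming radiation
before `v₁`. [cite: Kehrberger2022AHP, Thm. 6.1 and §6.2] -/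
def scatteringField : ℝ → ℝ → ℝ := fun u v ↦
  (scatWeight M v₁ v)⁻¹ * scatFixedPoint hr hM hHc hHb hH0 (u, v)

/-- The weighted field is the fixed point: `ω ψ = φ⋆`, i.e. `scatIntegrand φ⋆ = V ψ`. [folklore] -/
lemma scatIntegrand_fixedPoint :
    scatIntegrand M r v₁ (scatFixedPoint hr hM hHc hHb hH0) =
      fun u v ↦ radialPotential M (r u v) * scatteringField hr hM hHc hHb hH0 u v := by
  funext u v; rfl

/-- `ψ` is jointly continuous. [folklore] -/
theorem continuous_scatteringField : Continuous (uncurry (scatteringField hr hM hHc hHb hH0)) :=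
  ((continuous_scatWeight_inv M v₁).comp continuous_snd).mul (scatFixedPoint hr hM hHc hHb hH0).continuous

/-- `V ψ` is continuous. [folklore] -/
lemma continuous_potential_mul_scatteringField :
    Continuous (uncurry fun u v ↦ radialPotential M (r u v) * scatteringField hr hM hHc hHb hH0 u v) := by
  rw [← scatIntegrand_fixedPoint]; exact continuous_scatIntegrand hr hM _

/-- `V ψ` is potential-dominated. [folklore] -/
lemma isPotentialDominated_potential_mul_scatteringField :
    IsPotentialDominated M r (fun u v ↦ radialPotential M (r u v) * scatteringField hr hM hHc hHb hH0 u v) := by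
  rw [← scatIntegrand_fixedPoint]; exact isPotentialDominated_scatIntegrand hr hM _

/-- **`ψ = 0` on `{v ≤ v₁}`.** [cite: Kehrberger2022AHP, Thm. 6.1] -/
theorem scatteringField_eq_zero {u v : ℝ} (hv : v ≤ v₁) : scatteringField hr hM hHc hHb hH0 u v = 0 := by
  have h := congrArg (fun φ : ℝ × ℝ →ᵇ ℝ ↦ φ (u, v)) (scatFixedPoint_isFixedPt hr hM hHc hHb hH0)
  simp only [scatOp_apply] at h
  rw [scatteringField, ← h, scatOpFun_eq_zero hH0 _ (show (u, v).2 ≤ v₁ from hv), mul_zero]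

/-- **The integrated equation** `ψ = H − ∫_{v₁}^{v} ∫_{−∞}^{u} V ψ`. [cite: Kehrberger2022AHP, §6.2] -/
theorem scatteringField_eq (u v : ℝ) :
    scatteringField hr hM hHc hHb hH0 u v = H v -
      vPrimitive v₁ (uPrimitive fun u v ↦ radialPotential M (r u v) *
        scatteringField hr hM hHc hHb hH0 u v) u v := by
  rcases le_or_gt v v₁ with hv | hv
  · rw [scatteringField_eq_zero hr hM hHc hHb hH0 hv, hH0 v hv, vPrimitive_eq_zero_of_le _ hv, sub_zero]
    intro u' v' hv'
    exact uPrimitive_eq_zero_of_le (v₁ := v₁) (fun u'' v'' hv'' ↦ by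
      rw [scatteringField_eq_zero hr hM hHc hHb hH0 hv'', mul_zero]) hv'
  · have h := congrArg (fun φ : ℝ × ℝ →ᵇ ℝ ↦ φ (u, v)) (scatFixedPoint_isFixedPt hr hM hHc hHb hH0)
    simp only [scatOp_apply, scatOpFun, max_eq_left hv.le] at h
    rw [← scatIntegrand_fixedPoint, scatteringField, ← h]
    have hw := scatWeight_ne_zero M v₁ v
    field_simp

/-- **Bound on past strips**: `|ψ| ≤ ‖φ⋆‖ ω(V)⁻¹` on `{v ≤ V}` (all `u`). [folklore] -/
theorem abs_scatteringField_le (V : ℝ) :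
    ∃ B : ℝ, ∀ u v, v ≤ V → |scatteringField hr hM hHc hHb hH0 u v| ≤ B := by
  refine ⟨(scatWeight M v₁ V)⁻¹ * ‖scatFixedPoint hr hM hHc hHb hH0‖, fun u v hv ↦ ?_⟩
  rw [scatteringField, abs_mul, abs_of_pos (inv_pos.2 (scatWeight_pos M v₁ v))]
  exact mul_le_mul (scatWeight_inv_le hM hv) (abs_apply_le_norm _ _) (abs_nonneg _)
    (inv_pos.2 (scatWeight_pos M v₁ V)).le

/-- **`∂ᵤψ = −∫_{v₁}^{v} V ψ`.** [folklore] -/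
theorem hasDerivAt_scatteringField_left (u v : ℝ) :
    HasDerivAt (fun u' ↦ scatteringField hr hM hHc hHb hH0 u' v)
      (-vPrimitive v₁ (fun u v ↦ radialPotential M (r u v) * scatteringField hr hM hHc hHb hH0 u v) u v) u := by
  set g : ℝ → ℝ → ℝ := fun u v ↦ radialPotential M (r u v) * scatteringField hr hM hHc hHb hH0 u v with hg
  have hgc : Continuous (uncurry g) := continuous_potential_mul_scatteringField hr hM hHc hHb hH0
  have hgd : IsPotentialDominated M r g := isPotentialDominated_potential_mul_scatteringField hr hM hHc hHb hH0
  have hIc : Continuous (uncurry (uPrimitive g)) := continuous_uPrimitive hr hM hgd hgc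
  have hI : ∀ u v, HasDerivAt (fun u' ↦ uPrimitive g u' v) (g u v) u :=
    fun u v ↦ hasDerivAt_uPrimitive_left hr hM hgd hgc u v
  have h1 := hasDerivAt_vPrimitive_left (v₁ := v₁) hIc hgc hI u v
  have heq : (fun u' ↦ scatteringField hr hM hHc hHb hH0 u' v) =
      fun u' ↦ H v - vPrimitive v₁ (uPrimitive g) u' v :=
    funext fun u' ↦ scatteringField_eq hr hM hHc hHb hH0 u' v
  rw [heq]
  exact h1.const_sub (H v)

/-- **`∂ᵥψ = H' − ∫_{−∞}^{u} V ψ`** (for differentiable `H`). [folklore] -/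
theorem hasDerivAt_scatteringField_right {H₁ : ℝ → ℝ} (hHd : ∀ v, HasDerivAt H (H₁ v) v) (u v : ℝ) :
    HasDerivAt (fun v' ↦ scatteringField hr hM hHc hHb hH0 u v')
      (H₁ v - uPrimitive (fun u v ↦ radialPotential M (r u v) * scatteringField hr hM hHc hHb hH0 u v) u v) v := by
  set g : ℝ → ℝ → ℝ := fun u v ↦ radialPotential M (r u v) * scatteringField hr hM hHc hHb hH0 u v with hg
  have hgc : Continuous (uncurry g) := continuous_potential_mul_scatteringField hr hM hHc hHb hH0
  have hgd : IsPotentialDominated M r g := isPotentialDominated_potential_mul_scatteringField hr hM hHc hHb hH0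
  have hIc : Continuous (uncurry (uPrimitive g)) := continuous_uPrimitive hr hM hgd hgc
  have h1 := hasDerivAt_vPrimitive_right (v₁ := v₁) hIc u v
  have heq : (fun v' ↦ scatteringField hr hM hHc hHb hH0 u v') =
      fun v' ↦ H v' - vPrimitive v₁ (uPrimitive g) u v' :=
    funext fun v' ↦ scatteringField_eq hr hM hHc hHb hH0 u v'
  rw [heq]
  exact (hHd v).sub h1

/-- `M/r(u,v)² ≤ M/r(u,v₁)²` for `v ≥ v₁` (`r` increases in `v`). [folklore] -/
lemma div_sq_le_div_sq_right {u v : ℝ} (hv : v₁ ≤ v) : M / r u v ^ 2 ≤ M / r u v₁ ^ 2 := by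
  have h1 : r u v₁ ≤ r u v := (hr.strictMono_right hM u).monotone hv
  have h2 : 0 < r u v₁ := hr.pos hM.le u v₁
  gcongr

/-- **`ψ` attains its data on `𝓘⁻`**: `ψ(u, v) → H(v)` as `u → −∞`, for every `v`.
[cite: Kehrberger2022AHP, Thm. 6.1] -/
theorem tendsto_scatteringField_atBot (v : ℝ) :
    Tendsto (fun u ↦ scatteringField hr hM hHc hHb hH0 u v) atBot (𝓝 (H v)) := by
  rcases le_or_gt v v₁ with hv | hv
  · have : (fun u ↦ scatteringField hr hM hHc hHb hH0 u v) = fun _ ↦ H v := by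
      funext u; rw [scatteringField_eq_zero hr hM hHc hHb hH0 hv, hH0 v hv]
    rw [this]; exact tendsto_const_nhds
  set g : ℝ → ℝ → ℝ := fun u v ↦ radialPotential M (r u v) * scatteringField hr hM hHc hHb hH0 u v with hg
  obtain ⟨B, hB0, hB⟩ := (isPotentialDominated_potential_mul_scatteringField hr hM hHc hHb hH0).exists_nonneg
    hr hM v
  -- `|ψ(u,v) − H(v)| ≤ (v − v₁) B M/r(u,v₁)²`
  have hbound : ∀ u, |scatteringField hr hM hHc hHb hH0 u v - H v| ≤ (v - v₁) * (B * (M / r u v₁ ^ 2)) := by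
    intro u
    rw [scatteringField_eq hr hM hHc hHb hH0 u v, sub_sub_cancel_left, abs_neg]
    refine abs_vPrimitive_le hv.le fun v' hv' ↦ ?_
    refine (abs_uPrimitive_le hr hM (fun u' ↦ hB u' v' hv'.2)).trans ?_
    exact mul_le_mul_of_nonneg_left (div_sq_le_div_sq_right hr hM hv'.1) hB0
  have hlim : Tendsto (fun u ↦ (v - v₁) * (B * (M / r u v₁ ^ 2))) atBot (𝓝 0) := by
    simpa using ((hr.tendsto_div_sq_atBot hM v₁).const_mul B).const_mul (v - v₁)
  have h0 : Tendsto (fun u ↦ scatteringField hr hM hHc hHb hH0 u v - H v) atBot (𝓝 0) :=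
    squeeze_zero_norm (fun u ↦ by rw [Real.norm_eq_abs]; exact hbound u) hlim
  simpa using h0.add_const (H v)

end FixedPoint

/-! ### Polynomial multipliers in `1/r` and the two coefficient identities -/

section Poly

open Polynomial

variable {M : ℝ} {r : ℝ → ℝ → ℝ}

/-- `V(r) = 2M ρ³ − 4M² ρ⁴` with `ρ = 1/r`: the potential as a polynomial in the inverse radius. [folklore] -/
def potentialPoly (M : ℝ) : ℝ[X] := C (2 * M) * X ^ 3 - C (4 * M ^ 2) * X ^ 4

/-- `∂ᵤ(1/r) = (1 − 2M/r)/r² = ρ² − 2Mρ³`: the `u`-derivative of the inverse radius as a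
polynomial in it. [folklore] -/
def invRadiusDerivPoly (M : ℝ) : ℝ[X] := X ^ 2 - C (2 * M) * X ^ 3

/-- The polynomial `εᵥ(P) = (8M X² − 3X) P − (X² − 2M X³) P'` with
`∂ᵥ (V · P(1/r)) = V · εᵥ(P)(1/r)`. [folklore] -/
def potentialDerivPoly (M : ℝ) (P : ℝ[X]) : ℝ[X] :=
  (C (8 * M) * X ^ 2 - C 3 * X) * P - (X ^ 2 - C (2 * M) * X ^ 3) * derivative P

/-- The coefficient identity behind `∂ᵥ (V P(ρ)) = V εᵥ(P)(ρ)`: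
`−(V P)' · Q = V · εᵥ(P)` in `ℝ[X]` (`Q = X² − 2M X³`). [folklore] -/
lemma potentialPoly_identity (M : ℝ) (P : ℝ[X]) :
    -(derivative (potentialPoly M * P)) * invRadiusDerivPoly M = potentialPoly M * potentialDerivPoly M P := by
  simp only [potentialPoly, invRadiusDerivPoly, potentialDerivPoly, derivative_mul, derivative_sub,
    derivative_pow, derivative_C, derivative_X, map_mul, map_pow, map_ofNat,
    Nat.cast_ofNat, mul_zero, add_zero, mul_one]
  norm_num
  ring

variable (hr : IsEFAreaRadius M r) (hM : 0 < M)
include hr hM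

/-- `V(r(u,v)) = potentialPoly.eval (1/r(u,v))`. [folklore] -/
lemma radialPotential_eq_eval (u v : ℝ) :
    radialPotential M (r u v) = (potentialPoly M).eval (r u v)⁻¹ := by
  have h0 : r u v ≠ 0 := (hr.pos hM.le u v).ne'
  simp only [radialPotential, potentialPoly, eval_sub, eval_mul, eval_C, eval_pow, eval_X]
  field_simp
  ring

/-- `∂ᵤ (1/r) = Q(1/r)`, `Q = X² − 2M X³`. [folklore] -/
lemma hasDerivAt_invRadius_left (u v : ℝ) :
    HasDerivAt (fun u' ↦ (r u' v)⁻¹) ((invRadiusDerivPoly M).eval (r u v)⁻¹) u := by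
  have h0 : r u v ≠ 0 := (hr.pos hM.le u v).ne'
  have h := (hr.hasDerivAt_fst u v).inv h0
  refine h.congr_deriv ?_
  simp only [invRadiusDerivPoly, eval_sub, eval_mul, eval_C, eval_pow, eval_X]
  field_simp

/-- `∂ᵥ (1/r) = −Q(1/r)`. [folklore] -/
lemma hasDerivAt_invRadius_right (u v : ℝ) :
    HasDerivAt (fun v' ↦ (r u v')⁻¹) (-(invRadiusDerivPoly M).eval (r u v)⁻¹) v := by
  have h0 : r u v ≠ 0 := (hr.pos hM.le u v).ne'
  have h := (hr.hasDerivAt_snd u v).inv h0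
  refine h.congr_deriv ?_
  simp only [invRadiusDerivPoly, eval_sub, eval_mul, eval_C, eval_pow, eval_X]
  field_simp

/-- `(u, v) ↦ P(1/r(u,v))` is continuous. [folklore] -/
lemma continuous_eval_invRadius (P : ℝ[X]) : Continuous (fun p : ℝ × ℝ ↦ P.eval (r p.1 p.2)⁻¹) := by
  have hc : Continuous (uncurry r) := (hr.contDiff_uncurry hM).continuous
  exact P.continuous.comp (hc.inv₀ fun p ↦ (hr.pos hM.le p.1 p.2).ne')

/-- `P(1/r(u,v))` is bounded (`0 < 1/r < 1/2M`). [folklore] -/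
lemma exists_bound_eval_invRadius (P : ℝ[X]) : ∃ C, ∀ u v, |P.eval (r u v)⁻¹| ≤ C := by
  obtain ⟨C, hC⟩ := (isCompact_Icc (a := (0 : ℝ)) (b := (2 * M)⁻¹)).exists_bound_of_continuousOn
    P.continuous.continuousOn
  refine ⟨C, fun u v ↦ ?_⟩
  have h2 : 2 * M < r u v := hr.1 u v
  have h0 : 0 < r u v := hr.pos hM.le u v
  have hmem : (r u v)⁻¹ ∈ Icc (0 : ℝ) (2 * M)⁻¹ :=
    ⟨(inv_pos.2 h0).le, (inv_le_inv₀ h0 (by positivity)).2 h2.le⟩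
  simpa [Real.norm_eq_abs] using hC _ hmem

/-- `∂ᵤ P(1/r) = (P' Q)(1/r)`. [folklore] -/
lemma hasDerivAt_eval_invRadius_left (P : ℝ[X]) (u v : ℝ) :
    HasDerivAt (fun u' ↦ P.eval (r u' v)⁻¹) ((derivative P * invRadiusDerivPoly M).eval (r u v)⁻¹) u := by
  have h := (P.hasDerivAt ((r u v)⁻¹)).comp u (hasDerivAt_invRadius_left hr hM u v)
  refine h.congr_deriv ?_
  simp [eval_mul]

/-- `∂ᵥ P(1/r) = −(P' Q)(1/r)`. [folklore] -/
lemma hasDerivAt_eval_invRadius_right (P : ℝ[X]) (u v : ℝ) :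
    HasDerivAt (fun v' ↦ P.eval (r u v')⁻¹) (-(derivative P * invRadiusDerivPoly M).eval (r u v)⁻¹) v := by
  have h := (P.hasDerivAt ((r u v)⁻¹)).comp v (hasDerivAt_invRadius_right hr hM u v)
  refine h.congr_deriv ?_
  simp [eval_mul]

end Poly

/-! ### The bootstrap family and its closure under partial derivatives -/

section Family

open Polynomial

/-- The data of the regularity bootstrap: smooth data `H` all of whose derivatives vanish on
`(−∞, v₁]`, and a continuous field `ψ`, bounded on past strips, vanishing on `{v ≤ v₁}`, with the
partial derivatives `∂ᵤψ = −∫_{v₁}^{v} Vψ` and `∂ᵥψ = H' − ∫_{−∞}^{u} Vψ` of the integrated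
scattering equation. [folklore] -/
structure ScatBootstrap (M : ℝ) (r : ℝ → ℝ → ℝ) (v₁ : ℝ) (H : ℝ → ℝ) (ψ : ℝ → ℝ → ℝ) : Prop where
  contDiff_data : ContDiff ℝ ((⊤ : ℕ∞) : WithTop ℕ∞) H
  data_zero : ∀ (j : ℕ) (v : ℝ), v ≤ v₁ → iteratedDeriv j H v = 0
  cont : Continuous (uncurry ψ)
  bdd : ∀ V : ℝ, ∃ B : ℝ, ∀ u v, v ≤ V → |ψ u v| ≤ B
  zero : ∀ u v, v ≤ v₁ → ψ u v = 0
  deriv_left : ∀ u v, HasDerivAt (fun u' ↦ ψ u' v)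
    (-vPrimitive v₁ (fun u v ↦ radialPotential M (r u v) * ψ u v) u v) u
  deriv_right : ∀ u v, HasDerivAt (fun v' ↦ ψ u v')
    (deriv H v - uPrimitive (fun u v ↦ radialPotential M (r u v) * ψ u v) u v) v

/-- **The bootstrap family**: the functions generated from `ψ` and the derivatives `H^{(j)}` of the
data by sums, multiplication by polynomials in `1/r`, the `v`-primitive from `v₁`, and the
`u`-primitive from `𝓘⁻` of `V · P(1/r) · f`. It contains both partial derivatives of each of its
members (`ScatFam.exists_hasDerivAt`), whence all members are smooth (`ScatFam.contDiff`).
[folklore] -/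
inductive ScatFam (M : ℝ) (r : ℝ → ℝ → ℝ) (v₁ : ℝ) (H : ℝ → ℝ) (ψ : ℝ → ℝ → ℝ) :
    (ℝ → ℝ → ℝ) → Prop where
  | sol : ScatFam M r v₁ H ψ ψ
  | data (j : ℕ) : ScatFam M r v₁ H ψ (fun _ v ↦ iteratedDeriv j H v)
  | add {f g : ℝ → ℝ → ℝ} : ScatFam M r v₁ H ψ f → ScatFam M r v₁ H ψ g →
      ScatFam M r v₁ H ψ (fun u v ↦ f u v + g u v)
  | smul (P : ℝ[X]) {f : ℝ → ℝ → ℝ} : ScatFam M r v₁ H ψ f →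
      ScatFam M r v₁ H ψ (fun u v ↦ P.eval (r u v)⁻¹ * f u v)
  | vprim {f : ℝ → ℝ → ℝ} : ScatFam M r v₁ H ψ f → ScatFam M r v₁ H ψ (vPrimitive v₁ f)
  | uprim (P : ℝ[X]) {f : ℝ → ℝ → ℝ} : ScatFam M r v₁ H ψ f →
      ScatFam M r v₁ H ψ (uPrimitive fun u v ↦ radialPotential M (r u v) * (P.eval (r u v)⁻¹ * f u v))

namespace ScatFam

variable {M : ℝ} {r : ℝ → ℝ → ℝ} {v₁ : ℝ} {H : ℝ → ℝ} {ψ f g : ℝ → ℝ → ℝ}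
variable (hr : IsEFAreaRadius M r) (hM : 0 < M) (hb : ScatBootstrap M r v₁ H ψ)
include hr hM hb

/-- **Invariants of the family**: every member is jointly continuous, bounded on past strips
`{v ≤ V}` (all `u`), and vanishes on `{v ≤ v₁}`. [folklore] -/
theorem regular (hf : ScatFam M r v₁ H ψ f) :
    Continuous (uncurry f) ∧ (∀ V : ℝ, ∃ B : ℝ, ∀ u v, v ≤ V → |f u v| ≤ B) ∧
      ∀ u v, v ≤ v₁ → f u v = 0 := by
  induction hf with
  | sol => exact ⟨hb.cont, hb.bdd, hb.zero⟩
  | data j =>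
    refine ⟨(hb.contDiff_data.continuous_iteratedDeriv j (by exact_mod_cast le_top)).comp continuous_snd,
      fun V ↦ ?_, fun u v hv ↦ hb.data_zero j v hv⟩
    obtain ⟨C, hC⟩ := (isCompact_Icc (a := v₁) (b := V)).exists_bound_of_continuousOn
      (hb.contDiff_data.continuous_iteratedDeriv j (by exact_mod_cast le_top)).continuousOn
    refine ⟨max C 0, fun u v hv ↦ ?_⟩
    show |iteratedDeriv j H v| ≤ max C 0
    rcases le_or_gt v v₁ with h | h
    · rw [hb.data_zero j v h, abs_zero]; exact le_max_right _ _
    · exact ((Real.norm_eq_abs _).symm.le.trans (hC v ⟨h.le, hv⟩)).trans (le_max_left _ _)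
  | add hf hg ihf ihg =>
    obtain ⟨hfc, hfb, hf0⟩ := ihf
    obtain ⟨hgc, hgb, hg0⟩ := ihg
    refine ⟨hfc.add hgc, fun V ↦ ?_, fun u v hv ↦ by simp [hf0 u v hv, hg0 u v hv]⟩
    obtain ⟨B, hB⟩ := hfb V; obtain ⟨B', hB'⟩ := hgb V
    exact ⟨B + B', fun u v hv ↦ (abs_add_le _ _).trans (add_le_add (hB u v hv) (hB' u v hv))⟩
  | smul P hf ih =>
    obtain ⟨hfc, hfb, hf0⟩ := ih
    obtain ⟨C, hC⟩ := exists_bound_eval_invRadius hr hM P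
    refine ⟨(continuous_eval_invRadius hr hM P).mul hfc, fun V ↦ ?_,
      fun u v hv ↦ by simp [hf0 u v hv]⟩
    obtain ⟨B, hB⟩ := hfb V
    refine ⟨C * B, fun u v hv ↦ ?_⟩
    rw [abs_mul]
    exact mul_le_mul (hC u v) (hB u v hv) (abs_nonneg _) ((abs_nonneg _).trans (hC u v))
  | vprim hf ih =>
    obtain ⟨hfc, hfb, hf0⟩ := ih
    refine ⟨continuous_vPrimitive hfc, fun V ↦ ?_, fun u v hv ↦ vPrimitive_eq_zero_of_le hf0 hv⟩
    obtain ⟨B, hB⟩ := hfb V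
    refine ⟨max ((V - v₁) * B) 0, fun u v hv ↦ ?_⟩
    rcases le_or_gt v v₁ with h | h
    · rw [vPrimitive_eq_zero_of_le hf0 h, abs_zero]; exact le_max_right _ _
    · have hB0 : 0 ≤ B := (abs_nonneg _).trans (hB u v hv)
      refine (abs_vPrimitive_le h.le fun v' hv' ↦ hB u v' (hv'.2.trans hv)).trans ?_
      exact (mul_le_mul_of_nonneg_right (by linarith) hB0).trans (le_max_left _ _)
  | @uprim P f hf ih =>
    obtain ⟨hfc, hfb, hf0⟩ := ih
    obtain ⟨C, hC⟩ := exists_bound_eval_invRadius hr hM P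
    have hgc : Continuous (uncurry fun u v ↦ P.eval (r u v)⁻¹ * f u v) :=
      (continuous_eval_invRadius hr hM P).mul hfc
    have hgb : ∀ V, ∃ B, ∀ u v, v ≤ V → |P.eval (r u v)⁻¹ * f u v| ≤ B := fun V ↦ by
      obtain ⟨B, hB⟩ := hfb V
      refine ⟨C * B, fun u v hv ↦ ?_⟩
      rw [abs_mul]
      exact mul_le_mul (hC u v) (hB u v hv) (abs_nonneg _) ((abs_nonneg _).trans (hC u v))
    have hhc : Continuous (uncurry fun u v ↦ radialPotential M (r u v) * (P.eval (r u v)⁻¹ * f u v)) :=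
      (continuous_potential hr hM).mul hgc
    have hhd : IsPotentialDominated M r (fun u v ↦ radialPotential M (r u v) * (P.eval (r u v)⁻¹ * f u v)) :=
      isPotentialDominated_potential_mul hgb fun u v ↦ (radialPotential_pos hM (hr.1 u v)).le
    refine ⟨continuous_uPrimitive hr hM hhd hhc, hhd.uPrimitive_bounded hr hM, fun u v hv ↦ ?_⟩
    exact uPrimitive_eq_zero_of_le (v₁ := v₁) (fun u' v' hv' ↦ by simp [hf0 u' v' hv']) hv

/-- Members are continuous. [folklore] -/
theorem continuous (hf : ScatFam M r v₁ H ψ f) : Continuous (uncurry f) := (regular hr hM hb hf).1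

/-- Members are bounded on past strips. [folklore] -/
theorem bounded (hf : ScatFam M r v₁ H ψ f) (V : ℝ) : ∃ B : ℝ, ∀ u v, v ≤ V → |f u v| ≤ B :=
  (regular hr hM hb hf).2.1 V

/-- Members vanish on `{v ≤ v₁}`. [folklore] -/
theorem eq_zero (hf : ScatFam M r v₁ H ψ f) {u v : ℝ} (hv : v ≤ v₁) : f u v = 0 :=
  (regular hr hM hb hf).2.2 u v hv

/-- The `u`-primitive integrands of the family are continuous. [folklore] -/
lemma continuous_uprimIntegrand (P : ℝ[X]) (hf : ScatFam M r v₁ H ψ f) :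
    Continuous (uncurry fun u v ↦ radialPotential M (r u v) * (P.eval (r u v)⁻¹ * f u v)) :=
  (continuous_potential hr hM).mul ((continuous_eval_invRadius hr hM P).mul (continuous hr hM hb hf))

/-- The `u`-primitive integrands of the family are potential-dominated. [folklore] -/
lemma isPotentialDominated_uprimIntegrand (P : ℝ[X]) (hf : ScatFam M r v₁ H ψ f) :
    IsPotentialDominated M r (fun u v ↦ radialPotential M (r u v) * (P.eval (r u v)⁻¹ * f u v)) := by
  obtain ⟨C, hC⟩ := exists_bound_eval_invRadius hr hM P
  refine isPotentialDominated_potential_mul (fun V ↦ ?_) fun u v ↦ (radialPotential_pos hM (hr.1 u v)).le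
  obtain ⟨B, hB⟩ := bounded hr hM hb hf V
  refine ⟨C * B, fun u v hv ↦ ?_⟩
  rw [abs_mul]
  exact mul_le_mul (hC u v) (hB u v hv) (abs_nonneg _) ((abs_nonneg _).trans (hC u v))

/-- **The family contains the partial derivatives of its members.** For every member `f` there
are members `f₁ = ∂ᵤf` and `f₂ = ∂ᵥf`. [folklore] -/
theorem exists_hasDerivAt (hf : ScatFam M r v₁ H ψ f) :
    ∃ f₁ f₂ : ℝ → ℝ → ℝ, ScatFam M r v₁ H ψ f₁ ∧ ScatFam M r v₁ H ψ f₂ ∧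
      (∀ u v, HasDerivAt (fun u' ↦ f u' v) (f₁ u v) u) ∧
      (∀ u v, HasDerivAt (fun v' ↦ f u v') (f₂ u v) v) := by
  induction hf with
  | sol =>
    refine ⟨_, _, smul (C (-1)) (vprim (smul (potentialPoly M) sol)),
      add (data 1) (smul (C (-1)) (uprim (C 1) sol)), fun u v ↦ ?_, fun u v ↦ ?_⟩
    · refine (hb.deriv_left u v).congr_deriv ?_
      simp only [eval_C, neg_mul, one_mul, neg_inj]
      congr 1
      funext u' v'
      rw [radialPotential_eq_eval hr hM]
    · refine (hb.deriv_right u v).congr_deriv ?_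
      simp only [iteratedDeriv_one, eval_C, one_mul, neg_mul, sub_eq_add_neg]
  | data j =>
    refine ⟨_, _, smul (C 0) sol, data (j + 1), fun u v ↦ ?_, fun u v ↦ ?_⟩
    · simpa using hasDerivAt_const u (iteratedDeriv j H v)
    · have hd := hb.contDiff_data.differentiable_iteratedDeriv j
        (by exact_mod_cast ENat.coe_lt_top j)
      show HasDerivAt (fun v' ↦ iteratedDeriv j H v') (iteratedDeriv (j + 1) H v) v
      rw [iteratedDeriv_succ]
      exact hd.differentiableAt.hasDerivAt
  | add hf hg ihf ihg =>
    obtain ⟨f₁, f₂, hf₁, hf₂, hdf₁, hdf₂⟩ := ihf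
    obtain ⟨g₁, g₂, hg₁, hg₂, hdg₁, hdg₂⟩ := ihg
    exact ⟨_, _, add hf₁ hg₁, add hf₂ hg₂, fun u v ↦ (hdf₁ u v).add (hdg₁ u v),
      fun u v ↦ (hdf₂ u v).add (hdg₂ u v)⟩
  | smul P hf ih =>
    obtain ⟨f₁, f₂, hf₁, hf₂, hd₁, hd₂⟩ := ih
    refine ⟨_, _, add (smul (derivative P * invRadiusDerivPoly M) hf) (smul P hf₁),
      add (smul (C (-1) * (derivative P * invRadiusDerivPoly M)) hf) (smul P hf₂),
      fun u v ↦ ?_, fun u v ↦ ?_⟩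
    · exact ((hasDerivAt_eval_invRadius_left hr hM P u v).mul (hd₁ u v)).congr_deriv (by ring)
    · refine ((hasDerivAt_eval_invRadius_right hr hM P u v).mul (hd₂ u v)).congr_deriv ?_
      simp only [eval_mul, eval_C]
      ring
  | vprim hf ih =>
    obtain ⟨f₁, f₂, hf₁, hf₂, hd₁, hd₂⟩ := ih
    refine ⟨_, _, vprim hf₁, hf, fun u v ↦ ?_, fun u v ↦ ?_⟩
    · exact hasDerivAt_vPrimitive_left (continuous hr hM hb hf) (continuous hr hM hb hf₁) hd₁ u v
    · exact hasDerivAt_vPrimitive_right (continuous hr hM hb hf) u v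
  | @uprim P f hf ih =>
    obtain ⟨f₁, f₂, hf₁, hf₂, hd₁, hd₂⟩ := ih
    refine ⟨_, _, smul (potentialPoly M * P) hf, add (uprim (potentialDerivPoly M P) hf) (uprim P hf₂),
      fun u v ↦ ?_, fun u v ↦ ?_⟩
    · refine (hasDerivAt_uPrimitive_left hr hM (isPotentialDominated_uprimIntegrand hr hM hb P hf)
        (continuous_uprimIntegrand hr hM hb P hf) u v).congr_deriv ?_
      rw [eval_mul, radialPotential_eq_eval hr hM, mul_assoc]
    · -- `∂ᵥ ∫_{-∞}^u V P(ρ) f = ∫_{-∞}^u (V εᵥ(P)(ρ) f + V P(ρ) f₂)`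
      have hh := isPotentialDominated_uprimIntegrand hr hM hb P hf
      have hhc := continuous_uprimIntegrand hr hM hb P hf
      have hA := isPotentialDominated_uprimIntegrand hr hM hb (potentialDerivPoly M P) hf
      have hAc := continuous_uprimIntegrand hr hM hb (potentialDerivPoly M P) hf
      have hB := isPotentialDominated_uprimIntegrand hr hM hb P hf₂
      have hBc := continuous_uprimIntegrand hr hM hb P hf₂
      have hsum := uPrimitive_add hr hM hA hAc hB hBc
      have key := hasDerivAt_uPrimitive_right hr hM hh hhc (hA.add hB) (hAc.add hBc) (fun u v ↦ ?_) u v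
      · rw [hsum] at key
        exact key
      · -- pointwise `v`-derivative of the integrand
        have h1 : HasDerivAt (fun v' ↦ (potentialPoly M * P).eval (r u v')⁻¹ * f u v')
            (-(derivative (potentialPoly M * P) * invRadiusDerivPoly M).eval (r u v)⁻¹ * f u v +
              (potentialPoly M * P).eval (r u v)⁻¹ * f₂ u v) v :=
          (hasDerivAt_eval_invRadius_right hr hM _ u v).mul (hd₂ u v)
        have heq : (fun v' ↦ radialPotential M (r u v') * (P.eval (r u v')⁻¹ * f u v')) =
            fun v' ↦ (potentialPoly M * P).eval (r u v')⁻¹ * f u v' := by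
          funext v'; rw [eval_mul, radialPotential_eq_eval hr hM, mul_assoc]
        rw [heq]
        refine h1.congr_deriv ?_
        have hid := congrArg (fun Q : ℝ[X] ↦ Q.eval (r u v)⁻¹) (potentialPoly_identity M P)
        simp only [eval_mul, eval_neg] at hid
        rw [radialPotential_eq_eval hr hM]
        simp only [eval_mul, neg_mul] at hid ⊢
        linear_combination (f u v) * hid

/-! ### Smoothness of the family -/

omit hr hM hb in
/-- `toSpanSingleton ℝ c = c • 1` on `ℝ`. [folklore] -/
lemma toSpanSingleton_eq_smul_one (c : ℝ) :
    ContinuousLinearMap.toSpanSingleton ℝ c = c • (1 : ℝ →L[ℝ] ℝ) := by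
  ext; simp [mul_comm]

omit hr hM hb in
/-- The total derivative assembled from the two partials: `(a • 1).coprod (b • 1) = a • fst + b • snd`.
[folklore] -/
lemma coprod_smul_one (a b : ℝ) :
    (a • (1 : ℝ →L[ℝ] ℝ)).coprod (b • (1 : ℝ →L[ℝ] ℝ)) =
      a • ContinuousLinearMap.fst ℝ ℝ ℝ + b • ContinuousLinearMap.snd ℝ ℝ ℝ := by
  ext <;> simp

/-- **All members of the family are `C^k`, for every `k`** (induction on `k`: a member has
continuous partial derivatives which are members, hence `C^k` by induction, so it is `C^{k+1}` by
the criterion `hasStrictFDerivAt_uncurry_coprod`). [folklore] -/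
theorem contDiff_nat : ∀ (k : ℕ) {f : ℝ → ℝ → ℝ}, ScatFam M r v₁ H ψ f → ContDiff ℝ k (uncurry f) := by
  intro k
  induction k with
  | zero => intro f hf; exact contDiff_zero.2 (continuous hr hM hb hf)
  | succ k ih =>
    intro f hf
    obtain ⟨f₁, f₂, hf₁, hf₂, hd₁, hd₂⟩ := exists_hasDerivAt hr hM hb hf
    have hc₁ : Continuous (uncurry f₁) := continuous hr hM hb hf₁
    have hc₂ : Continuous (uncurry f₂) := continuous hr hM hb hf₂
    -- the total derivative at every point
    have hderiv : ∀ p : ℝ × ℝ, HasFDerivAt (uncurry f)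
        (f₁ p.1 p.2 • ContinuousLinearMap.fst ℝ ℝ ℝ + f₂ p.1 p.2 • ContinuousLinearMap.snd ℝ ℝ ℝ) p := by
      intro p
      have h := hasStrictFDerivAt_uncurry_coprod (𝕜 := ℝ) (u := p) (f := f)
        (f₁ := fun u v ↦ f₁ u v • (1 : ℝ →L[ℝ] ℝ)) (f₂ := fun u v ↦ f₂ u v • (1 : ℝ →L[ℝ] ℝ))
        (Eventually.of_forall fun q ↦ by
          show HasFDerivAt (fun x ↦ f x q.2) (f₁ q.1 q.2 • (1 : ℝ →L[ℝ] ℝ)) q.1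
          rw [← toSpanSingleton_eq_smul_one]
          exact (hd₁ q.1 q.2).hasFDerivAt)
        (Eventually.of_forall fun q ↦ by
          show HasFDerivAt (fun x ↦ f q.1 x) (f₂ q.1 q.2 • (1 : ℝ →L[ℝ] ℝ)) q.2
          rw [← toSpanSingleton_eq_smul_one]
          exact (hd₂ q.1 q.2).hasFDerivAt)
        ((hc₁.smul continuous_const).continuousAt) ((hc₂.smul continuous_const).continuousAt)
      have h' := h.hasFDerivAt
      rw [show (↿fun u v ↦ f₁ u v • (1 : ℝ →L[ℝ] ℝ)) p = f₁ p.1 p.2 • (1 : ℝ →L[ℝ] ℝ) from rfl,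
        show (↿fun u v ↦ f₂ u v • (1 : ℝ →L[ℝ] ℝ)) p = f₂ p.1 p.2 • (1 : ℝ →L[ℝ] ℝ) from rfl,
        coprod_smul_one] at h'
      exact h'
    have hfd : fderiv ℝ (uncurry f) = fun p ↦
        f₁ p.1 p.2 • ContinuousLinearMap.fst ℝ ℝ ℝ + f₂ p.1 p.2 • ContinuousLinearMap.snd ℝ ℝ ℝ :=
      funext fun p ↦ (hderiv p).fderiv
    rw [show ((k + 1 : ℕ) : WithTop ℕ∞) = (k : WithTop ℕ∞) + 1 by push_cast; rfl,
      contDiff_succ_iff_fderiv]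
    refine ⟨fun p ↦ (hderiv p).differentiableAt, fun h ↦ absurd h (by exact_mod_cast WithTop.coe_ne_top),
      ?_⟩
    rw [hfd]
    exact ((ih hf₁).smul contDiff_const).add ((ih hf₂).smul contDiff_const)

/-- **All members of the family are smooth.** [folklore] -/
theorem contDiff (hf : ScatFam M r v₁ H ψ f) : ContDiff ℝ ((⊤ : ℕ∞) : WithTop ℕ∞) (uncurry f) :=
  contDiff_infty.2 fun k ↦ contDiff_nat hr hM hb k hf

end ScatFam

end Family

/-! ### Assembly: the scattering solution for smooth compactly supported data -/

section Assembly

variable {M : ℝ} {r : ℝ → ℝ → ℝ} {G : ℝ → ℝ} {v₁ v₂ : ℝ}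

/-- The support of an iterated derivative is contained in the support of the function. [folklore] -/
lemma tsupport_iteratedDeriv_subset (G : ℝ → ℝ) : ∀ j : ℕ, tsupport (iteratedDeriv j G) ⊆ tsupport G
  | 0 => by simp [iteratedDeriv_zero]
  | j + 1 => by
    rw [iteratedDeriv_succ]
    exact tsupport_deriv_subset.trans (tsupport_iteratedDeriv_subset G j)

/-- All derivatives of data supported in `(v₁, v₂)` vanish on `(−∞, v₁]`. [folklore] -/
lemma iteratedDeriv_eq_zero_of_tsupport (hsupp : tsupport G ⊆ Ioo v₁ v₂) (j : ℕ) {v : ℝ}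
    (hv : v ≤ v₁) : iteratedDeriv j G v = 0 := by
  refine image_eq_zero_of_notMem_tsupport fun h ↦ ?_
  have := hsupp (tsupport_iteratedDeriv_subset G j h)
  exact absurd this.1 (not_lt.2 hv)

/-- Continuous data supported in `(v₁, v₂)` are bounded. [folklore] -/
lemma exists_bound_of_tsupport (hGc : Continuous G) (hsupp : tsupport G ⊆ Ioo v₁ v₂) :
    ∃ C : ℝ, ∀ v, |G v| ≤ C := by
  obtain ⟨C, hC⟩ := (isCompact_Icc (a := v₁) (b := v₂)).exists_bound_of_continuousOn hGc.continuousOn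
  refine ⟨max C 0, fun v ↦ ?_⟩
  by_cases hv : v ∈ Icc v₁ v₂
  · exact ((Real.norm_eq_abs _).symm.le.trans (hC v hv)).trans (le_max_left _ _)
  · rw [Set.mem_Icc, not_and_or, not_le, not_le] at hv
    have h0 : G v = 0 := eq_zero_of_tsupport_subset_Ioo hsupp (by
      rcases hv with h | h
      · exact Or.inl h.le
      · exact Or.inr h.le)
    rw [h0, abs_zero]; exact le_max_right _ _

variable (hr : IsEFAreaRadius M r) (hM : 0 < M) (hG : ContDiff ℝ ((⊤ : ℕ∞) : WithTop ℕ∞) G)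
  (hsupp : tsupport G ⊆ Ioo v₁ v₂)
include hr hM hG hsupp

omit hr hM hG in
/-- The data vanish on `(−∞, v₁]`. [folklore] -/
lemma data_eq_zero : ∀ v, v ≤ v₁ → G v = 0 :=
  fun _ hv ↦ eq_zero_of_tsupport_subset_Ioo hsupp (Or.inl hv)

/-- **The scattering field of smooth compactly supported data satisfies the bootstrap hypotheses.**
[folklore] -/
theorem scatBootstrap_scatteringField {CG : ℝ} (hGb : ∀ v, |G v| ≤ CG) :
    ScatBootstrap M r v₁ G
      (scatteringField hr hM hG.continuous hGb (data_eq_zero hsupp)) where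
  contDiff_data := hG
  data_zero j v hv := iteratedDeriv_eq_zero_of_tsupport hsupp j hv
  cont := continuous_scatteringField hr hM _ _ _
  bdd := abs_scatteringField_le hr hM _ _ _
  zero _ _ hv := scatteringField_eq_zero hr hM _ _ _ hv
  deriv_left := hasDerivAt_scatteringField_left hr hM _ _ _
  deriv_right u v := hasDerivAt_scatteringField_right hr hM _ _ _
    (fun v ↦ ((hG.differentiable (by simp)).differentiableAt).hasDerivAt) u v

/-- **The scattering field is a scattering solution** in the sense of `IsScatteringSolution`:
smooth radiation field (the wave equation in the nesting `∂ᵤ(∂ᵥψ)` is `∂ᵤ(G' − ∫_{−∞}^{u} Vψ) = −Vψ`),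
vanishing for `v ≤ v₁`, attaining `G` on `𝓘⁻`, bounded on past quadrants.
[cite: Kehrberger2022AHP, Thm. 6.1 and Thm. 6.2 (first paragraph)] -/
theorem isScatteringSolution_scatteringField {CG : ℝ} (hGb : ∀ v, |G v| ≤ CG) :
    IsScatteringSolution M r v₁ G
      (scatteringField hr hM hG.continuous hGb (data_eq_zero hsupp)) := by
  set ψ := scatteringField hr hM hG.continuous hGb (data_eq_zero hsupp) with hψ
  have hb := scatBootstrap_scatteringField hr hM hG hsupp hGb
  have hGd : ∀ v, HasDerivAt G (deriv G v) v :=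
    fun v ↦ ((hG.differentiable (by simp)).differentiableAt).hasDerivAt
  set g : ℝ → ℝ → ℝ := fun u v ↦ radialPotential M (r u v) * ψ u v with hg
  have hgc : Continuous (uncurry g) := continuous_potential_mul_scatteringField hr hM _ _ _
  have hgd : IsPotentialDominated M r g := isPotentialDominated_potential_mul_scatteringField hr hM _ _ _
  refine ⟨⟨ScatFam.contDiff hr hM hb ScatFam.sol, fun u v ↦ ?_⟩,
    fun u v hv ↦ scatteringField_eq_zero hr hM _ _ _ hv, tendsto_scatteringField_atBot hr hM _ _ _,
    fun U V ↦ ?_⟩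
  · -- the wave equation
    have hinner : (fun u' ↦ deriv (fun v' ↦ ψ u' v') v) = fun u' ↦ deriv G v - uPrimitive g u' v :=
      funext fun u' ↦ (hasDerivAt_scatteringField_right hr hM _ _ _ hGd u' v).deriv
    rw [hinner, ((hasDerivAt_uPrimitive_left hr hM hgd hgc u v).const_sub (deriv G v)).deriv, hg]
    simp only
    rw [neg_radialPotential_mul, neg_mul]
  · obtain ⟨B, hB⟩ := abs_scatteringField_le hr hM hG.continuous hGb (data_eq_zero hsupp) V
    exact ⟨B, fun u _ v hv ↦ hB u v hv⟩

omit hr hM hG hsupp in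
/-- **Discharge of `SchwarzschildLinearScattering_exists`**: the scattering solution exists
(Kehrberger, Thm. 6.2: "there exists a unique smooth scattering solution"; here by the fixed point of
the integrated equation and the regularity bootstrap of this file).
[cite: Kehrberger2022AHP, Thm. 6.2 (first paragraph) and Thm. 6.1] -/
theorem SchwarzschildLinearScattering_exists_holds : SchwarzschildLinearScattering_exists := by
  intro M hM r hr G v₁ v₂ _ hG hsupp
  obtain ⟨CG, hGb⟩ := exists_bound_of_tsupport hG.continuous hsupp
  exact ⟨_, isScatteringSolution_scatteringField hr hM hG hsupp hGb⟩

end Assembly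

end Literature.Barriers.FinalStateConjecture

end
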